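import Mathlib
import Summits.SmoothPoincare4.SmoothPoincare4.Theorems.SullivanDualTameOrBrodyR4CoreAKernel
import Literature.Analysis.Complex.SimilarityZeroFree

/-!
# CORE-A of crux `TameOrBrodyR4` (stmt-SmoothPoincare4-7826), line `Sketch`: a kernel element of
# the full linearisation with constant part `(0, β')`, `β' ≠ 0`, has zero-free second component
(stub `helper_kernelZeroFree`, NT1; lead c6, CORE-A wave 3)

CORE-A's family of pencil members `Φ(b)` through the base member `u₀` must be NOWHERE TANGENT:
`∂_b Φ β'` is never in the range of `∂_ξ Φ` unless `β' = 0`. In the chart the `b`-derivative at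
the centre is `Ψ η` with `η = (0, β') + T(χ₁ h)`, where `(β', h)` lies in the kernel of the FULL
linearisation of the vorticity map: `h + χ • S₁ ((0, β') + T(χ₁ h)) = 0`. Tangency at `ξ` means
`(η ξ).2 = 0`; here we show `(η ξ).2 ≠ 0` for every `ξ`:

* bootstrapping the identity `χ₁ h = -χ₁ χ • S₁ ((0, β') + T(χ₁ h))` through the Hölder scale
  (exactly as in the sibling `CoreA.kernel_trivial`, with the Cauchy-transform package
  `Literature.Analysis.Complex.cauchyTransform_contDiffHolder_succ`) shows that `T(χ₁ h)` is
  smooth, `∂̄ T(χ₁ h) = χ₁ h = h` and `T(χ₁ h) → 0` at infinity;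
* hence `η` is smooth and solves the conjugated equation `2 ∂̄ η + S η = 0`;
* `S` is upper triangular, so the second component `η₂` solves the scalar equation
  `∂̄ η₂ = r₂`, `r₂ = -½ (S (0, η₂)).2`, with `‖r₂‖ ≤ (M/2) ‖η₂‖` and `r₂` supported in a disc
  (as in `helper_decayingKernelZero`), while `η₂ - β' = (T(χ₁ h)).2 → 0` at infinity;
* the zero-free form of the similarity principle
  (`Literature.Analysis.Complex.zeroFree_of_dbar_le_of_norm_sub_const_lt`) forbids zeros of `η₂`.

* `helper_kernelZeroFree` — the registered stub.
-/

-- the registered namespace `Summit.SmoothPoincare4.SmoothPoincare4.…` repeats a component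
set_option linter.dupNamespace false

noncomputable section

open scoped ContDiff Topology NNReal
open Filter Set Metric Literature.Analysis.Complex Literature.Analysis.FunctionSpaces

namespace Summit.SmoothPoincare4.SmoothPoincare4.Cruxes.TameOrBrodyR4.Sketch

namespace KernelZeroFree

variable {r : ℝ≥0}

/-- **Bootstrap.** Under the structural hypotheses of `helper_kernelZeroFree`, the cut-off density
`χ₁ • h` of a kernel element lies in `C^{m,r}_b` for every `m`: `χ₁ h = -χ₁ χ • S₁ ((0, β') + T(χ₁ h))`,
the first summand `-χ₁ χ • S₁ (0, β')` is smooth with compact support and the second gains one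
Hölder order per round (`cauchyTransform_contDiffHolder_succ`, `CoreA.memContDiffHolder_clm_apply_of_smooth`). -/
theorem density_mem (hr0 : 0 < r) (hr1 : r < 1) (hT : CauchyTransformHolderApriori (ℂ × ℂ) r)
    (χ χ₁ : ℂ → ℝ) (hχ : ContDiff ℝ ∞ χ) (hχ₁ : ContDiff ℝ ∞ χ₁) (ρ : ℝ) (hρ : 0 < ρ)
    (hχ₁ρ : ∀ z, ρ ≤ ‖z‖ → χ₁ z = 0)
    (S₁ : ℂ → (ℂ × ℂ) →L[ℝ] (ℂ × ℂ)) (hS₁s : ContDiff ℝ ∞ S₁)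
    (β' : ℂ) (h : ContDiffHolderFunction ℂ (ℂ × ℂ) 0 r)
    (hker : ∀ x, h x + χ x • S₁ x (((0 : ℂ), β') +
      cauchyTransformAlong (1 : ℂ) (fun w => χ₁ w • h w) x) = 0) (m : ℕ) :
    ∃ g : ContDiffHolderFunction ℂ (ℂ × ℂ) m r, (g : ℂ → ℂ × ℂ) = fun w => χ₁ w • h w := by
  have hT' := cauchyTransform_contDiffHolder_succ (ℂ × ℂ) hr0 hr1 hT
  have hr1' : r ≤ 1 := hr1.le
  set d : ℂ → ℂ × ℂ := fun w => χ₁ w • h w with hd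
  have hdz : ∀ z, ρ ≤ ‖z‖ → d z = 0 := fun z hz => by simp [hd, hχ₁ρ z hz]
  induction m with
  | zero =>
    exact ⟨ContDiffHolderFunction.coeffCLM hr1' χ₁ hχ₁ (CoreA.hasCompactSupport_of_eq_zero hχ₁ρ) h,
      funext fun _ => rfl⟩
  | succ m ih =>
    obtain ⟨g, hg⟩ := ih
    obtain ⟨C, -, hC⟩ := hT' m ρ hρ
    have hgz : ∀ z, ρ ≤ ‖z‖ → g z = 0 := fun z hz => by
      have := hdz z hz; rwa [← hg] at this
    obtain ⟨hmem, -, -, -⟩ := hC g hgz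
    -- the smooth compactly supported field `Φ = -χ₁ χ • S₁`
    have hΦ : ContDiff ℝ ∞ (fun x => (-(χ₁ x * χ x)) • S₁ x) := (hχ₁.mul hχ).neg.smul hS₁s
    have hΦs : HasCompactSupport (fun x => (-(χ₁ x * χ x)) • S₁ x) := by
      have hc : HasCompactSupport (fun x => -(χ₁ x * χ x)) :=
        ((CoreA.hasCompactSupport_of_eq_zero (f := χ₁) hχ₁ρ).mul_right (f' := χ)).neg
      exact hc.smul_right (f' := S₁)
    -- `Φ (0, β')` is smooth with compact support, `Φ (T g)` is in `C^{m+1,r}_b`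
    have hmem₁ : MemContDiffHolder (m + 1) r
        (fun x => ((-(χ₁ x * χ x)) • S₁ x) ((0 : ℂ), β')) := by
      refine MemContDiffHolder.of_contDiff_of_hasCompactSupport (hΦ.clm_apply contDiff_const)
        (hΦs.mono fun x hx => ?_) hr1'
      intro h0
      exact hx (by simp only [h0, zero_apply])
    have hmem₂ := CoreA.memContDiffHolder_clm_apply_of_smooth hr1' hΦ hΦs hmem
    have hmem' : MemContDiffHolder (m + 1) r (fun x => ((-(χ₁ x * χ x)) • S₁ x)
        (((0 : ℂ), β') + cauchyTransformAlong (1 : ℂ) (g : ℂ → ℂ × ℂ) x)) := by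
      have hfun : (fun x => ((-(χ₁ x * χ x)) • S₁ x)
          (((0 : ℂ), β') + cauchyTransformAlong (1 : ℂ) (g : ℂ → ℂ × ℂ) x)) =
          (fun x => ((-(χ₁ x * χ x)) • S₁ x) ((0 : ℂ), β')) +
            fun x => ((-(χ₁ x * χ x)) • S₁ x)
              (cauchyTransformAlong (1 : ℂ) (g : ℂ → ℂ × ℂ) x) := by
        funext x
        simp only [Pi.add_apply, map_add]
      rw [hfun]
      exact hmem₁.add hmem₂
    refine ⟨⟨fun x => (-(χ₁ x * χ x)) • S₁ x
      (((0 : ℂ), β') + cauchyTransformAlong (1 : ℂ) (g : ℂ → ℂ × ℂ) x), hmem'⟩, ?_⟩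
    funext x
    change (-(χ₁ x * χ x)) • S₁ x
      (((0 : ℂ), β') + cauchyTransformAlong (1 : ℂ) (g : ℂ → ℂ × ℂ) x) = d x
    rw [hg]
    have h1 : h x = -(χ x • S₁ x (((0 : ℂ), β') + cauchyTransformAlong (1 : ℂ) d x)) :=
      eq_neg_of_add_eq_zero_left (hker x)
    simp only [hd] at h1 ⊢
    rw [h1, smul_neg, neg_smul, smul_smul]

end KernelZeroFree

open DecayingKernelZero in
/-- **Registered helper `helper_kernelZeroFree` (NT1).** Let `S` be a smooth, bounded, compactly
supported, upper-triangular operator field, `χ, χ₁` real smooth cut-offs with `S = 0` where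
`χ ≠ 1` and `χ₁ = 1` where `χ ≠ 0`, `χ₁` vanishing off the `ρ`-disc, and `S₁` a smooth operator
field equal to `½ S` where `χ ≠ 0`. If `β' ≠ 0` and `h ∈ C^{0,r}_b` satisfy
`h + χ • S₁ ((0, β') + T(χ₁ h)) = 0` pointwise, then the second component of
`η = (0, β') + T(χ₁ h)` has no zeros: `η` is smooth with `2 ∂̄ η + S η = 0` and `η → (0, β')` at
infinity, so `η₂` solves `∂̄ η₂ = -½ (S (0, η₂)).2` with `η₂ → β' ≠ 0`, and the zero-free form of
the similarity principle applies. -/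
theorem helper_kernelZeroFree {r : ℝ≥0} (hr0 : 0 < r) (hr1 : r < 1)
    (hT : CauchyTransformHolderApriori (ℂ × ℂ) r)
    (S : ℂ → (ℂ × ℂ) →L[ℝ] (ℂ × ℂ)) (ρS M : ℝ) (hSs : ContDiff ℝ ∞ S)
    (hS : ∀ ξ, ρS ≤ ‖ξ‖ → S ξ = 0) (hM : ∀ ξ, ‖S ξ‖ ≤ M)
    (htri : ∀ ξ (y₁ : ℂ), S ξ (y₁, 0) = 0)
    (χ χ₁ : ℂ → ℝ) (hχ : ContDiff ℝ ∞ χ) (hχ₁ : ContDiff ℝ ∞ χ₁) (ρ : ℝ) (hρ : 0 < ρ)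
    (hχ₁ρ : ∀ z, ρ ≤ ‖z‖ → χ₁ z = 0)
    (hSχ : ∀ x, χ x ≠ 1 → S x = 0) (hχχ₁ : ∀ x, χ x ≠ 0 → χ₁ x = 1)
    (S₁ : ℂ → (ℂ × ℂ) →L[ℝ] (ℂ × ℂ)) (hS₁s : ContDiff ℝ ∞ S₁)
    (hS₁ : ∀ x, χ x ≠ 0 → S₁ x = (1 / 2 : ℝ) • S x)
    (β' : ℂ) (hβ' : β' ≠ 0) (h : ContDiffHolderFunction ℂ (ℂ × ℂ) 0 r)
    (hker : ∀ x, h x + χ x • S₁ x (((0 : ℂ), β') +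
      cauchyTransformAlong (1 : ℂ) (fun w => χ₁ w • h w) x) = 0) :
    ∀ x : ℂ, (((0 : ℂ), β') + cauchyTransformAlong (1 : ℂ) (fun w => χ₁ w • h w) x).2 ≠ 0 := by
  have hT' := cauchyTransform_contDiffHolder_succ (ℂ × ℂ) hr0 hr1 hT
  have hboot := KernelZeroFree.density_mem hr0 hr1 hT χ χ₁ hχ hχ₁ ρ hρ hχ₁ρ S₁ hS₁s β' h hker
  -- the density `d := χ₁ • h`, the function `w̃ := T d` and `η := (0, β') + w̃`
  set d : ℂ → ℂ × ℂ := fun w => χ₁ w • h w with hd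
  set wt : ℂ → ℂ × ℂ := cauchyTransformAlong (1 : ℂ) d with hwt
  have hdz : ∀ z, ρ ≤ ‖z‖ → d z = 0 := fun z hz => by simp [hd, hχ₁ρ z hz]
  -- `h` vanishes where `χ` does, hence `d = h`
  have hhχ : ∀ x, χ x = 0 → h x = 0 := fun x hx => by
    have := hker x; rw [hx, zero_smul, add_zero] at this; exact this
  have hdh : ∀ x, d x = h x := fun x => by
    by_cases hx : χ x = 0
    · simp [hd, hhχ x hx]
    · simp [hd, hχχ₁ x hx]
  -- the order-0 package for `d`: `∂̄ w̃ = d` and `w̃ → 0`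
  obtain ⟨g0, hg0⟩ := hboot 0
  obtain ⟨C0, -, hC0⟩ := hT' 0 ρ hρ
  have hg0z : ∀ z, ρ ≤ ‖z‖ → g0 z = 0 := fun z hz => by
    have := hdz z hz; rwa [← hg0] at this
  obtain ⟨-, -, hdbar0, hdec0⟩ := hC0 g0 hg0z
  rw [hg0] at hdbar0 hdec0
  -- smoothness of `w̃ = T d`
  have hsmooth : ContDiff ℝ ∞ wt := by
    rw [contDiff_infty]
    intro m
    obtain ⟨g, hg⟩ := hboot m
    obtain ⟨C, -, hC⟩ := hT' m ρ hρ
    have hgz : ∀ z, ρ ≤ ‖z‖ → g z = 0 := fun z hz => by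
      have := hdz z hz; rwa [← hg] at this
    obtain ⟨hmem, -, -, -⟩ := hC g hgz
    rw [hg] at hmem
    exact (hmem.contDiff).of_le (by exact_mod_cast Nat.le_succ m)
  have hwd : Differentiable ℝ wt := hsmooth.differentiable (by simp)
  -- `η := (0, β') + w̃`
  set η : ℂ → ℂ × ℂ := fun x => ((0 : ℂ), β') + wt x with hη
  have hηs : ContDiff ℝ ∞ η := contDiff_const.add hsmooth
  have hηd : Differentiable ℝ η := hηs.differentiable (by simp)
  have hdbarη : ∀ ξ, dbarAlong (1 : ℂ) η ξ = d ξ := fun ξ => by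
    rw [hη, dbarAlong_fun_add (differentiableAt_const _) (hwd ξ), hdbar0 ξ]
    simp [dbarAlong_apply]
  -- the conjugated equation `2∂̄η + S η = 0`
  have heq : ∀ ξ, (2 : ℂ) • dbarAlong (1 : ℂ) η ξ + S ξ (η ξ) = 0 := by
    intro ξ
    rw [hdbarη ξ, hdh ξ]
    have hx : h ξ + χ ξ • S₁ ξ (η ξ) = 0 := hker ξ
    by_cases h1 : χ ξ = 1
    · rw [h1, one_smul, hS₁ ξ (by rw [h1]; exact one_ne_zero)] at hx
      -- `h ξ + ½ S (η ξ) = 0`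
      have h2 : h ξ = -((1 / 2 : ℝ) • S ξ (η ξ)) := eq_neg_of_add_eq_zero_left hx
      rw [h2, smul_neg]
      have : ((2 : ℂ)) • (1 / 2 : ℝ) • (S ξ) (η ξ) = S ξ (η ξ) := by
        rw [two_smul, ← add_smul]; norm_num
      rw [this, neg_add_cancel]
    · have hS0 : S ξ = 0 := hSχ ξ h1
      have hh0 : h ξ = 0 := by
        by_cases h0 : χ ξ = 0
        · exact hhχ ξ h0
        · rw [hS₁ ξ h0, hS0] at hx; simpa using hx
      rw [hh0, hS0]; simp
  -- triangularity: `∂̄ η = -½ S ξ (0, (η ξ).2)`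
  have hcomp : ∀ ξ, dbarAlong (1 : ℂ) η ξ = -((2 : ℂ)⁻¹ • S ξ (0, (η ξ).2)) := fun ξ => by
    have h3 := heq ξ
    rw [apply_eq_apply_zero_snd (S ξ) (htri ξ) (η ξ)] at h3
    exact eq_neg_half_smul h3
  have hSv : ContDiff ℝ ∞ fun ξ => S ξ (0, (η ξ).2) :=
    hSs.clm_apply (contDiff_const.prodMk hηs.snd)
  -- the second component: `∂̄ η₂ = r₂`, `‖r₂‖ ≤ (M/2) ‖η₂‖`, `r₂ = 0` far out
  set G : ℂ → ℂ := fun ξ => (η ξ).2 with hG_def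
  set rr : ℂ → ℂ := fun ξ => -((2 : ℂ)⁻¹ * (S ξ (0, (η ξ).2)).2) with hrr_def
  have hGs : ContDiff ℝ ∞ G := hηs.snd
  have hrrs : ContDiff ℝ ∞ rr := (contDiff_const.mul hSv.snd).neg
  have hdbarG : ∀ ξ, dbarAlong (1 : ℂ) G ξ = rr ξ := fun ξ => by
    rw [hG_def, ← snd_dbarAlong (hηd ξ), hcomp ξ]
    simp [hrr_def]
  have hMG : ∀ ξ, ‖rr ξ‖ ≤ M / 2 * ‖G ξ‖ := fun ξ => by
    have h1 : ‖(S ξ (0, (η ξ).2)).2‖ ≤ M * ‖(η ξ).2‖ :=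
      calc ‖(S ξ (0, (η ξ).2)).2‖ ≤ ‖S ξ (0, (η ξ).2)‖ := norm_snd_le _
        _ ≤ ‖S ξ‖ * ‖((0 : ℂ), (η ξ).2)‖ := (S ξ).le_opNorm _
        _ ≤ M * ‖(η ξ).2‖ := by
            rw [norm_zero_mk]
            exact mul_le_mul_of_nonneg_right (hM ξ) (norm_nonneg _)
    have h2 : ‖rr ξ‖ = 2⁻¹ * ‖(S ξ (0, (η ξ).2)).2‖ := by
      rw [hrr_def, norm_neg, norm_mul, norm_inv, Complex.norm_two]
    rw [h2]
    show 2⁻¹ * ‖(S ξ (0, (η ξ).2)).2‖ ≤ M / 2 * ‖(η ξ).2‖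
    linarith
  have hsuppG : ∀ ξ, ρS ≤ ‖ξ‖ → rr ξ = 0 := fun ξ hξ => by simp [hrr_def, hS ξ hξ]
  -- far behaviour: `η₂ - β' = (w̃).2 → 0`
  have hlim₂ : Tendsto (fun ξ => (wt ξ).2) (cocompact ℂ) (𝓝 0) := by
    have h3 := (continuous_snd.tendsto (0 : ℂ × ℂ)).comp hdec0
    rw [Prod.snd_zero] at h3
    exact h3
  obtain ⟨R, hR⟩ :=
    Similarity.exists_forall_norm_lt_of_tendsto_cocompact hlim₂ (norm_pos_iff.2 hβ')
  have hfar : ∀ ξ, max ρS R ≤ ‖ξ‖ → ‖G ξ - β'‖ < ‖β'‖ := fun ξ hξ => by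
    have h3 := hR ξ ((le_max_right _ _).trans hξ)
    have h4 : G ξ - β' = (wt ξ).2 := by simp [hG_def, hη]
    rw [h4]
    exact h3
  have hsupp' : ∀ ξ, max ρS R ≤ ‖ξ‖ → rr ξ = 0 := fun ξ hξ =>
    hsuppG ξ ((le_max_left _ _).trans hξ)
  have key := zeroFree_of_dbar_le_of_norm_sub_const_lt G rr (M / 2) (max ρS R) hβ' hGs hrrs
    hdbarG hMG hsupp' hfar
  intro x
  exact key x

end Summit.SmoothPoincare4.SmoothPoincare4.Cruxes.TameOrBrodyR4.Sketch

end
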